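/-
Copyright (c) 2026 the pub-hodgecm-mathlib formalisation cell (harness21).  Prover seat hodgecm-mathlib-K2Liu-p05 (g4), 2026-09-04
(Track B «K2-LIT», crux hLiu418 = stmt-HodgeConjecture-24832, LEAD F0P6-plan (g13) RULINGS M-157m∕M-157s organ (SD-1-ind), END file (V-4):
the archimedean Whittaker coefficient of a `K_w`-finite FLAT weight-`k` section on `U(2,2)` as a finite combination of COMPLEX `g`-LINE derivatives
`(d∕dτ)^d xiShift (1 + τ•Ξ) h α β |_{τ=0}` — LEAD's letter, with explicit polynomial-in-`s` scalar jets).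
-/
import Summits.HodgeConjecture.HodgeConjecture.Theorems.K2LiuKFiniteSectionWhittakerAsHLineDerivatives   -- ★ (V-4b) h-side END (this seat)
import Summits.HodgeConjecture.HodgeConjecture.Theorems.K2LiuXiTwoHLineAsGLine                          -- (V-L2′) bridge (this seat; ★ xiTwo_levi inside)
import Summits.HodgeConjecture.HodgeConjecture.Theorems.K2LiuHermTwoXiShiftParamHolomorphy              -- ★ (SD-2) (7b) K2E5-p16: g-line holomorphy
import Mathlib.Analysis.Calculus.IteratedDeriv.Lemmas
import Mathlib.Analysis.Complex.CauchyIntegral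
import HarnessLib

/-!
# (SD-1-ind, V-4) END: `W_h(s; f) = Σ_j κ_j Σ_i C(e_j,i)·(d∕dτ)^i det(1+τΞ_j)^{c_j(s)}|₀ · (d∕dτ)^{e_j−i} xiShift (1 + τ•Ξ_j) h α_j(s) β_j(s)|₀`

Track B ∕ K2-LIT, hLiu418 = stmt-HodgeConjecture-24832; LEAD F0P6-plan (g13) RULING M-157m (1) (the letter) + M-157s (the bridge).  Namespace
`Summit.HodgeConjecture.HodgeConjecture.Cruxes.HLiu418.K2LiuKFiniteSectionWhittakerAsXiDerivatives`.  THEOREMS ONLY; `--supports stmt-HodgeConjecture-24832 --as helper`.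

THE STATEMENT (`exists_whittaker_eq_sum_iteratedDeriv_xiShift`).  Given the polynomial `P` (common restriction to `K_w` of a flat family) and the weight `k`,
there are — depending on `P, k` ONLY — a finite index set `J` of pairs `(monomial, (Θ_j hermitian, e_j))`, constants `κ_j ∈ ℂ`, shifts `m_j, n_j ∈ ℕ` and
`s₀ ∈ ℝ` such that for EVERY positive definite `h`, every `s` with `re s > s₀` and every Siegel section `f` of `I_w(s, χ_k)` with `f|_{K_w} = P`:
  `∫ f(J·transl x) e(−tr(hx)) dx = Σ_{j∈J} κ_j · Σ_{i ≤ e_j} C(e_j, i) · iteratedDeriv i (τ ↦ det(1 + τΞ_j)^{α_j + β_j − 2}) 0 · iteratedDeriv (e_j − i) (τ ↦ xiShift (1 + τΞ_j) h α_j β_j) 0`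
with COMPLEX `τ`, `Ξ_j = h^{−½} Θ_j h^{−½}` (`(CFC.sqrt h)⁻¹ * Θ_j * (CFC.sqrt h)⁻¹`, EXPORTED explicitly), `α_j = s + 1 − k∕2 + m_j`, `β_j = s + 1 + k∕2 + n_j`
(so `α_j + β_j − 2 = 2s + m_j + n_j`: the scalar jets are polynomials in `s, tr Ξ_j, det Ξ_j` — K2E5-p16 (g5)'s junction bounds them).
CHAIN: ★ (V-4b) (uniform in `h`, §0) → (V-L2′) `eventually_xiTwo_hLine_eq_gLine` + ★ `xiShift_eq_xiTwo` (real `t` near `0`) → real = complex `iteratedDeriv` for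
restrictions of holomorphic functions (§1, `HasDerivAt.comp_ofReal` + `Filter.EventuallyEq.iteratedDeriv_eq`) → Leibniz `iteratedDeriv_mul` on the complex
side (holomorphy: §2 for the determinant power, ★ (7b) `exists_differentiableOn_xiShift_param` for the `xiShift` line).

HONEST LABEL: HC_CM is proved only modulo the 7 printed citations (2 remaining named inputs: hLiu418 = stmt-HodgeConjecture-24832, h413 =
stmt-HodgeConjecture-24833) until rung 0 closes; organ capital, moves no counter.

## References
[Shimura1997] G. Shimura, *Euler Products and Eisenstein Series*, CBMS 93 (1997), §16 · G. Shimura, Math. Ann. 260 (1982), §3.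
-/

set_option autoImplicit false
set_option linter.dupNamespace false

noncomputable section

open scoped Matrix ComplexConjugate ComplexOrder MatrixOrder Topology
open Complex Matrix MeasureTheory Filter
open Literature.NumberTheory.ModularForms.SiegelUpperHalfSpace (moeb)
open Summit.HodgeConjecture.HodgeConjecture.Cruxes.HLiu418.K2LiuHermTwoGammaDefs
open Summit.HodgeConjecture.HodgeConjecture.Cruxes.HLiu418.K2LiuHermTwoConfluentXiDefs
open Summit.HodgeConjecture.HodgeConjecture.Cruxes.HLiu418.K2LiuHermTwoEtaShiftDefs (xiShift)
open Summit.HodgeConjecture.HodgeConjecture.Cruxes.HLiu418.K2LiuHermTwoXiBetaShift (xiShift_eq_xiTwo)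
open Summit.HodgeConjecture.HodgeConjecture.Cruxes.HLiu418.K2LiuHermTwoXiShiftParamHolomorphy (exists_differentiableOn_xiShift_param)
open Summit.HodgeConjecture.HodgeConjecture.Cruxes.HLiu418.K2LiuXiTwoMomentsAsHDerivatives
open Summit.HodgeConjecture.HodgeConjecture.Cruxes.HLiu418.K2LiuPolynomialsAsHermitianTracePowers
open Summit.HodgeConjecture.HodgeConjecture.Cruxes.HLiu418.K2LiuKFiniteSectionWhittakerAsHLineDerivatives
open Summit.HodgeConjecture.HodgeConjecture.Cruxes.HLiu418.K2LiuXiTwoHLineAsGLine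

namespace Summit.HodgeConjecture.HodgeConjecture.Cruxes.HLiu418.K2LiuKFiniteSectionWhittakerAsXiDerivatives

/-! ## §0 ★ (V-4b) with the data chosen BEFORE `h` (they depend on `P, k` only) -/

/-- ★ (V-4b) `exists_whittaker_eq_sum_iteratedDeriv_hLine` with the quantifier order `∃ data, ∀ h`: the finite data depend on `P, k` only.
[cite: Shimura1997, §16.4] -/
theorem exists_whittaker_eq_sum_iteratedDeriv_hLine_uniform
    (P : MvPolynomial (((Fin 2 ⊕ Fin 2) × (Fin 2 ⊕ Fin 2)) ⊕ ((Fin 2 ⊕ Fin 2) × (Fin 2 ⊕ Fin 2))) ℂ) (k : ℤ) :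
    ∃ (J : Finset (Σ _ : ((Fin 2 × Fin 2) ⊕ (Fin 2 × Fin 2)) →₀ ℕ, {M : Matrix (Fin 2) (Fin 2) ℂ // M.IsHermitian} × ℕ))
      (κ : (Σ _ : ((Fin 2 × Fin 2) ⊕ (Fin 2 × Fin 2)) →₀ ℕ, {M : Matrix (Fin 2) (Fin 2) ℂ // M.IsHermitian} × ℕ) → ℂ)
      (m n : (Σ _ : ((Fin 2 × Fin 2) ⊕ (Fin 2 × Fin 2)) →₀ ℕ, {M : Matrix (Fin 2) (Fin 2) ℂ // M.IsHermitian} × ℕ) → ℕ) (s₀ : ℝ),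
      ∀ (h : Matrix (Fin 2) (Fin 2) ℂ), h.IsHermitian → ∀ (s : ℂ), s₀ < s.re → ∀ (f : Matrix (Fin 2 ⊕ Fin 2) (Fin 2 ⊕ Fin 2) ℂ → ℂ),
        K2LiuArchInducedTubeDefs.IsArchSiegelSection (fun z : ℂ => (conj z / ((‖z‖ : ℝ) : ℂ)) ^ k) s f →
        (∀ u : Matrix (Fin 2 ⊕ Fin 2) (Fin 2 ⊕ Fin 2) ℂ, uᴴ * Matrix.J (Fin 2) ℂ * u = Matrix.J (Fin 2) ℂ → moeb u (I • (1 : Matrix (Fin 2) (Fin 2) ℂ)) = I • 1 →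
          f u = MvPolynomial.eval (Sum.elim (fun pq => u pq.1 pq.2) (fun pq => conj (u pq.1 pq.2))) P) →
        ∫ c : ℝ × ℂ × ℝ, f (Matrix.J (Fin 2) ℂ * fromBlocks 1 (hermTwo c) 0 1) * cexp (-(2 * Real.pi * I) * (h * hermTwo c).trace) =
          ∑ j ∈ J, κ j * iteratedDeriv j.2.2
            (fun t : ℝ => xiTwo 1 (h + (t : ℂ) • (j.2.1 : Matrix (Fin 2) (Fin 2) ℂ)) (s + 1 - k / 2 + m j) (s + 1 + k / 2 + n j)) 0 := by
  classical
  obtain ⟨ι, Pd, m, n, hmom⟩ := exists_uniform_moments P k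
  -- (V-4a): each weight as a combination of hermitian trace powers
  choose κ hκ using fun d => exists_finsupp_eq_sum_tracePow (Pd d)
  refine ⟨ι.sigma fun d => (κ d).support, fun j => κ j.1 j.2 * ((-(2 * Real.pi * I))⁻¹) ^ j.2.2, fun j => m j.1, fun j => n j.1,
    1 + ∑ j ∈ ι.sigma fun d => (κ d).support, (j.2.2 : ℝ), fun h hh s hs f hf hP => ?_⟩
  -- exponent bookkeeping: `re(A_d + B_d) = 2 re s + 2 + m_d + n_d`
  have hre : ∀ d, ((s + 1 - (k : ℂ) / 2 + (m d : ℕ)) + (s + 1 + (k : ℂ) / 2 + (n d : ℕ))).re = 2 * s.re + 2 + m d + n d := by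
    intro d
    rw [show (s + 1 - (k : ℂ) / 2 + (m d : ℕ)) + (s + 1 + (k : ℂ) / 2 + (n d : ℕ)) = s + s + ((2 + m d + n d : ℕ) : ℂ) by push_cast; ring,
      Complex.add_re, Complex.add_re, Complex.natCast_re]
    push_cast
    ring
  have hAB : ∀ j ∈ ι.sigma (fun d => (κ d).support),
      3 + (j.2.2 : ℝ) < ((s + 1 - (k : ℂ) / 2 + (m j.1 : ℕ)) + (s + 1 + (k : ℂ) / 2 + (n j.1 : ℕ))).re := by
    intro j hj
    have hej : (j.2.2 : ℝ) ≤ ∑ j ∈ ι.sigma (fun d => (κ d).support), (j.2.2 : ℝ) :=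
      Finset.single_le_sum (f := fun j : (Σ _ : ((Fin 2 × Fin 2) ⊕ (Fin 2 × Fin 2)) →₀ ℕ, {M : Matrix (Fin 2) (Fin 2) ℂ // M.IsHermitian} × ℕ) =>
        (j.2.2 : ℝ)) (fun _ _ => Nat.cast_nonneg _) hj
    rw [hre]
    have hm : (0 : ℝ) ≤ m j.1 := Nat.cast_nonneg _
    have hn : (0 : ℝ) ≤ n j.1 := Nat.cast_nonneg _
    linarith
  -- Step 1: the integrand, expanded pointwise
  have hpt : ∀ c : ℝ × ℂ × ℝ,
      f (Matrix.J (Fin 2) ℂ * fromBlocks 1 (hermTwo c) 0 1) * cexp (-(2 * Real.pi * I) * (h * hermTwo c).trace) =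
        ∑ j ∈ ι.sigma (fun d => (κ d).support), κ j.1 j.2 *
          (((j.2.1 : Matrix (Fin 2) (Fin 2) ℂ) * hermTwo c).trace ^ j.2.2 * xiTwoIntegrand 1 h (s + 1 - k / 2 + m j.1) (s + 1 + k / 2 + n j.1) c) := by
    intro c
    rw [hmom s f hf hP h c, Finset.sum_sigma]
    refine Finset.sum_congr rfl fun d _ => ?_
    conv_lhs => rw [← hκ d]
    rw [Finsupp.sum, map_sum, Finset.sum_mul]
    refine Finset.sum_congr rfl fun p _ => ?_
    rw [MvPolynomial.smul_eq_C_mul, map_mul, MvPolynomial.eval_C, map_pow, eval_tracePoly, mul_assoc]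
  -- Step 2: each term is integrable
  have hint : ∀ j ∈ ι.sigma (fun d => (κ d).support), Integrable (fun c : ℝ × ℂ × ℝ => κ j.1 j.2 *
      (((j.2.1 : Matrix (Fin 2) (Fin 2) ℂ) * hermTwo c).trace ^ j.2.2 * xiTwoIntegrand 1 h (s + 1 - k / 2 + m j.1) (s + 1 + k / 2 + n j.1) c)) := by
    intro j hj
    have hdeg := totalDegree_tracePoly_pow_le (j.2.1 : Matrix (Fin 2) (Fin 2) ℂ) j.2.2
    have h0 := integrable_moment ((∑ jk : Fin 2 × Fin 2, MvPolynomial.C ((j.2.1 : Matrix (Fin 2) (Fin 2) ℂ) jk.2 jk.1) * MvPolynomial.X jk) ^ j.2.2) hh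
      (A := s + 1 - k / 2 + m j.1) (B := s + 1 + k / 2 + n j.1)
      (by have h1 := hAB j hj; have h2 : ((((∑ jk : Fin 2 × Fin 2, MvPolynomial.C ((j.2.1 : Matrix (Fin 2) (Fin 2) ℂ) jk.2 jk.1) * MvPolynomial.X jk) ^ j.2.2 :
            MvPolynomial (Fin 2 × Fin 2) ℂ).totalDegree : ℕ) : ℝ) ≤ j.2.2 := by exact_mod_cast hdeg
          linarith)
    refine (h0.const_mul (κ j.1 j.2)).congr (Filter.Eventually.of_forall fun c => ?_)
    simp only [map_pow, eval_tracePoly]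
  -- Step 3: integrate termwise and recognise the derivatives
  rw [integral_congr_ae (Filter.Eventually.of_forall hpt), integral_finsetSum _ hint]
  refine Finset.sum_congr rfl fun j hj => ?_
  rw [integral_const_mul, integral_tracePow_mul_xiTwoIntegrand hh j.2.1.2 j.2.2 (hAB j hj)]
  beta_reduce
  ring


/-! ## §1 Real versus complex `iteratedDeriv` for restrictions of holomorphic functions -/

/-- **restriction to the real line commutes with `iteratedDeriv`** for a function holomorphic on a ball around `0`. [folklore] -/
theorem iteratedDeriv_ofReal_comp {Φ : ℂ → ℂ} {r : ℝ} (hΦ : DifferentiableOn ℂ Φ (Metric.ball 0 r)) (n : ℕ) {x : ℝ} (hx : |x| < r) :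
    iteratedDeriv n (fun t : ℝ => Φ (t : ℂ)) x = iteratedDeriv n Φ (x : ℂ) := by
  induction n generalizing Φ x with
  | zero => simp only [iteratedDeriv_zero]
  | succ n ih =>
    rw [iteratedDeriv_succ', iteratedDeriv_succ']
    -- near `x` the real derivative is the restriction of the complex one
    have hev : deriv (fun t : ℝ => Φ (t : ℂ)) =ᶠ[𝓝 x] fun t : ℝ => deriv Φ (t : ℂ) := by
      have hopen : IsOpen {t : ℝ | |t| < r} := isOpen_lt continuous_abs continuous_const
      filter_upwards [hopen.mem_nhds hx] with t ht
      have hmem : (t : ℂ) ∈ Metric.ball (0 : ℂ) r := by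
        rw [Metric.mem_ball, dist_zero_right, Complex.norm_real, Real.norm_eq_abs]; exact ht
      exact ((hΦ.differentiableAt (Metric.isOpen_ball.mem_nhds hmem)).hasDerivAt.comp_ofReal).deriv
    rw [hev.iteratedDeriv_eq n]
    exact ih (hΦ.deriv Metric.isOpen_ball) hx

/-- a function holomorphic on a ball around `0` is `C^n` at `0` (for Leibniz). [folklore] -/
theorem contDiffAt_of_differentiableOn_ball {Φ : ℂ → ℂ} {r : ℝ} (hr : 0 < r) (hΦ : DifferentiableOn ℂ Φ (Metric.ball 0 r)) (n : ℕ) :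
    ContDiffAt ℂ n Φ 0 :=
  (hΦ.analyticAt (Metric.isOpen_ball.mem_nhds (Metric.mem_ball_self hr))).contDiffAt

/-! ## §2 The scalar `τ ↦ det(1 + τΞ)^c` is holomorphic near `0` -/

/-- `τ ↦ det(1 + τΞ)` is an entire (polynomial) function. [folklore] -/
theorem differentiable_det_one_add_smul (Ξ : Matrix (Fin 2) (Fin 2) ℂ) : Differentiable ℂ fun τ : ℂ => (1 + τ • Ξ).det := by
  have h : (fun τ : ℂ => (1 + τ • Ξ).det) = fun τ : ℂ => (1 + τ * Ξ 0 0) * (1 + τ * Ξ 1 1) - (τ * Ξ 0 1) * (τ * Ξ 1 0) := by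
    funext τ
    rw [Matrix.det_fin_two]
    simp [Matrix.add_apply, Matrix.smul_apply]
  rw [h]
  fun_prop

/-- **`τ ↦ det(1 + τΞ)^c` is holomorphic on a ball around `0`** (`det(1 + 0·Ξ) = 1` lies in the slit plane, which is open). [folklore] -/
theorem exists_differentiableOn_det_cpow (Ξ : Matrix (Fin 2) (Fin 2) ℂ) (c : ℂ) :
    ∃ ρ : ℝ, 0 < ρ ∧ DifferentiableOn ℂ (fun τ : ℂ => (1 + τ • Ξ).det ^ c) (Metric.ball 0 ρ) := by
  have hcont : ContinuousAt (fun τ : ℂ => (1 + τ • Ξ).det) 0 := (differentiable_det_one_add_smul Ξ).continuous.continuousAt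
  have h0 : (1 + (0 : ℂ) • Ξ).det ∈ slitPlane := by simp [Complex.one_mem_slitPlane]
  have hev : ∀ᶠ τ in 𝓝 (0 : ℂ), (1 + τ • Ξ).det ∈ slitPlane := hcont.preimage_mem_nhds (Complex.isOpen_slitPlane.mem_nhds h0)
  obtain ⟨ρ, hρ, hball⟩ := Metric.eventually_nhds_iff_ball.mp hev
  exact ⟨ρ, hρ, fun τ hτ => ((differentiable_det_one_add_smul Ξ τ).cpow_const (hball τ hτ)).differentiableWithinAt⟩

/-! ## §3 The assembly: LEAD's `g`-line letter -/

/-- **(SD-1-ind) END.  THE ARCHIMEDEAN WHITTAKER COEFFICIENT OF A `K_w`-FINITE FLAT WEIGHT-`k` SECTION ON `U(2,2)` AS A FINITE COMBINATION OF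
COMPLEX `g`-LINE DERIVATIVES OF `xiShift`** — data depending on `P, k` only; `Ξ_j = h^{−½} Θ_j h^{−½}` and the scalar jets exported explicitly.
[cite: Shimura1997, §16.4] -/
theorem exists_whittaker_eq_sum_iteratedDeriv_xiShift
    (P : MvPolynomial (((Fin 2 ⊕ Fin 2) × (Fin 2 ⊕ Fin 2)) ⊕ ((Fin 2 ⊕ Fin 2) × (Fin 2 ⊕ Fin 2))) ℂ) (k : ℤ) :
    ∃ (J : Finset (Σ _ : ((Fin 2 × Fin 2) ⊕ (Fin 2 × Fin 2)) →₀ ℕ, {M : Matrix (Fin 2) (Fin 2) ℂ // M.IsHermitian} × ℕ))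
      (κ : (Σ _ : ((Fin 2 × Fin 2) ⊕ (Fin 2 × Fin 2)) →₀ ℕ, {M : Matrix (Fin 2) (Fin 2) ℂ // M.IsHermitian} × ℕ) → ℂ)
      (m n : (Σ _ : ((Fin 2 × Fin 2) ⊕ (Fin 2 × Fin 2)) →₀ ℕ, {M : Matrix (Fin 2) (Fin 2) ℂ // M.IsHermitian} × ℕ) → ℕ) (s₀ : ℝ),
      ∀ (h : Matrix (Fin 2) (Fin 2) ℂ), h.PosDef → ∀ (s : ℂ), s₀ < s.re → ∀ (f : Matrix (Fin 2 ⊕ Fin 2) (Fin 2 ⊕ Fin 2) ℂ → ℂ),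
        K2LiuArchInducedTubeDefs.IsArchSiegelSection (fun z : ℂ => (conj z / ((‖z‖ : ℝ) : ℂ)) ^ k) s f →
        (∀ u : Matrix (Fin 2 ⊕ Fin 2) (Fin 2 ⊕ Fin 2) ℂ, uᴴ * Matrix.J (Fin 2) ℂ * u = Matrix.J (Fin 2) ℂ → moeb u (I • (1 : Matrix (Fin 2) (Fin 2) ℂ)) = I • 1 →
          f u = MvPolynomial.eval (Sum.elim (fun pq => u pq.1 pq.2) (fun pq => conj (u pq.1 pq.2))) P) →
        ∫ c : ℝ × ℂ × ℝ, f (Matrix.J (Fin 2) ℂ * fromBlocks 1 (hermTwo c) 0 1) * cexp (-(2 * Real.pi * I) * (h * hermTwo c).trace) =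
          ∑ j ∈ J, κ j * ∑ i ∈ Finset.range (j.2.2 + 1), ((j.2.2.choose i : ℕ) : ℂ) *
            iteratedDeriv i (fun τ : ℂ => (1 + τ • ((CFC.sqrt h)⁻¹ * (j.2.1 : Matrix (Fin 2) (Fin 2) ℂ) * (CFC.sqrt h)⁻¹)).det ^
              ((s + 1 - k / 2 + m j) + (s + 1 + k / 2 + n j) - 2)) 0 *
            iteratedDeriv (j.2.2 - i) (fun τ : ℂ => xiShift (1 + τ • ((CFC.sqrt h)⁻¹ * (j.2.1 : Matrix (Fin 2) (Fin 2) ℂ) * (CFC.sqrt h)⁻¹)) h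
              (s + 1 - k / 2 + m j) (s + 1 + k / 2 + n j)) 0 := by
  obtain ⟨J, κ, m, n, s₀, hW⟩ := exists_whittaker_eq_sum_iteratedDeriv_hLine_uniform P k
  refine ⟨J, κ, m, n, |s₀| + |(k : ℝ)| + 4, fun h hh s hs f hf hP => ?_⟩
  have hk : |(k : ℝ)| ≥ (k : ℝ) ∧ |(k : ℝ)| ≥ -(k : ℝ) := ⟨le_abs_self _, neg_le_abs _⟩
  have hs₀ : s₀ ≤ |s₀| := le_abs_self _
  have hk0 : 0 ≤ |(k : ℝ)| := abs_nonneg _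
  have hs₀' : 0 ≤ |s₀| := abs_nonneg _
  rw [hW h hh.1 s (by linarith) f hf hP]
  refine Finset.sum_congr rfl fun j _ => ?_
  congr 1
  -- the letters of the term `j`
  set Θ : Matrix (Fin 2) (Fin 2) ℂ := (j.2.1 : Matrix (Fin 2) (Fin 2) ℂ) with hΘdef
  set Ξ : Matrix (Fin 2) (Fin 2) ℂ := (CFC.sqrt h)⁻¹ * Θ * (CFC.sqrt h)⁻¹ with hΞdef
  set A : ℂ := s + 1 - k / 2 + m j with hA
  set B : ℂ := s + 1 + k / 2 + n j with hB
  have hΘ : Θ.IsHermitian := j.2.1.2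
  have hΞ : Ξ.IsHermitian := conjTranspose_bridgeDir h hΘ
  have hAre : 3 < A.re := by
    have : A.re = s.re + 1 - (k : ℝ) / 2 + m j := by rw [hA]; simp
    rw [this]; have hm : (0 : ℝ) ≤ m j := Nat.cast_nonneg _; linarith
  have hBre : 1 < B.re := by
    have : B.re = s.re + 1 + (k : ℝ) / 2 + n j := by rw [hB]; simp
    rw [this]; have hn : (0 : ℝ) ≤ n j := Nat.cast_nonneg _; linarith
  -- holomorphy radii: the determinant power (§2) and the `xiShift` line (★ (7b) at `g₀ = 1 = hermTwo (1, 0, 1)`)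
  obtain ⟨ρ, hρ, hdet⟩ := exists_differentiableOn_det_cpow Ξ (A + B - 2)
  obtain ⟨r, K, hr, -, -, hxi⟩ := exists_differentiableOn_xiShift_param (d := ((1 : ℝ), (0 : ℂ), (1 : ℝ))) (by norm_num) Ξ
  have hxi' : DifferentiableOn ℂ (fun τ : ℂ => xiShift (1 + τ • Ξ) h A B) (Metric.ball 0 r) := by
    simpa only [hermTwo_one_zero_one] using hxi hh A (by linarith : 0 < B.re)
  set R : ℝ := min ρ r with hR
  have hRpos : 0 < R := lt_min hρ hr
  have hdetR : DifferentiableOn ℂ (fun τ : ℂ => (1 + τ • Ξ).det ^ (A + B - 2)) (Metric.ball 0 R) :=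
    hdet.mono (Metric.ball_subset_ball (min_le_left _ _))
  have hxiR : DifferentiableOn ℂ (fun τ : ℂ => xiShift (1 + τ • Ξ) h A B) (Metric.ball 0 R) :=
    hxi'.mono (Metric.ball_subset_ball (min_le_right _ _))
  have hprodR : DifferentiableOn ℂ (fun τ : ℂ => (1 + τ • Ξ).det ^ (A + B - 2) * xiShift (1 + τ • Ξ) h A B) (Metric.ball 0 R) := hdetR.mul hxiR
  -- Step 1: near `t = 0` the real `h`-line function IS the restriction of the complex product
  have hev : (fun t : ℝ => xiTwo 1 (h + (t : ℂ) • Θ) A B) =ᶠ[𝓝 0]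
      fun t : ℝ => (fun τ : ℂ => (1 + τ • Ξ).det ^ (A + B - 2) * xiShift (1 + τ • Ξ) h A B) (t : ℂ) := by
    filter_upwards [eventually_xiTwo_hLine_eq_gLine hh hΘ A B, eventually_posDef_add_smul PosDef.one hΞ] with t ht hpos
    rw [ht, xiShift_eq_xiTwo hpos hh hAre hBre]
  rw [hev.iteratedDeriv_eq, iteratedDeriv_ofReal_comp hprodR j.2.2 (by rw [abs_zero]; exact hRpos), Complex.ofReal_zero]
  -- Step 2: Leibniz on the complex side
  have hL := iteratedDeriv_mul (n := j.2.2) (x := (0 : ℂ)) (contDiffAt_of_differentiableOn_ball hRpos hdetR j.2.2)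
    (contDiffAt_of_differentiableOn_ball hRpos hxiR j.2.2)
  rw [show (fun τ : ℂ => (1 + τ • Ξ).det ^ (A + B - 2) * xiShift (1 + τ • Ξ) h A B) =
      (fun τ : ℂ => (1 + τ • Ξ).det ^ (A + B - 2)) * (fun τ : ℂ => xiShift (1 + τ • Ξ) h A B) from rfl, hL]

end Summit.HodgeConjecture.HodgeConjecture.Cruxes.HLiu418.K2LiuKFiniteSectionWhittakerAsXiDerivatives

end
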